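import Summits.AtomisticToContinuum.Crystallization.Theorems.PricedLinkCensusLocalToGlobalThomsonDefs
import Literature.Analysis.FluidPDE.HarmonicProbe
import Literature.Analysis.FluidPDE.HarmonicMeanValueLocal

/-!
# The regularised Newton kernel of `ℝ⁸` and its flux (line `flux-cell-joint-census`, Thomson step)

Route `PricedLinkCensus`, crux `LocalToGlobal` (stmt-AtomisticToContinuum-14232), line
`flux-cell-joint-census`, support for the registered stub `stub_confinedThomson : ConfinedThomson`
(`Theorems/PricedLinkCensusLocalToGlobalDefs`).  The kernel `‖z‖⁻⁶` appearing in `smearedPair` is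
`2π⁴` times the Newton kernel of `ℝ⁸` (`|S⁷| = π⁴/3`, `(8 - 2)|S⁷| = 2π⁴`).  The Thomson inequality
behind `ConfinedThomson` is proved (in the sequel files) by testing weak divergences against the
potentials of the REGULARISED kernel

  `f_t = (1 - θ_t) · ‖·‖⁻⁶`,  `θ_t = radialCutoff (t/2) t`  (smooth, `= ‖·‖⁻⁶` off `B(0,t)`, `= 0` on `B(0,t/2)`),

and letting `t → 0`.  This file is the kernel-level calculus, ported from the tree's `ℝ³` files
`Literature/Analysis/FluidPDE/NewtonKernel.lean`, `NewtonPotential.lean` (`Γ∞ = (1-θ)Γ`, `∫ ΔΓ∞ = 1`):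

* smoothness of the radial profile `farProfile8 t` (`g_t(σ) = (1 - Θ(σ)) σ⁻³`, defined with the kernel
  `newtonFar8 t`, `f_t(z) = g_t(‖z‖²)`, in `PricedLinkCensusLocalToGlobalThomsonDefs`) and of `f_t`;
* `laplacian_newtonFar8_eq` — `Δ f_t (z) = 4 g″(‖z‖²)‖z‖² + 16 g′(‖z‖²)` (tree `laplacian_comp_norm_sq`),
  vanishing for `‖z‖ < t/2` and for `‖z‖ > t` (there `f_t` is the harmonic `‖·‖⁻⁶`);
* `integral_laplacian_newtonFar8` — **the flux** `∫ Δ f_t = -2π⁴` (polar coordinates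
  `MeasureTheory.integral_fun_norm_addHaar`, `vol B₁(ℝ⁸) = π⁴/24`, and the fundamental theorem of calculus
  for `r⁷ Λ(r) = (2 r⁸ g′(r²))′`, `2 r⁸ g′(r²) = -6` beyond the cut-off);
(The representation off the core `∫ Δf_t(x) f_t(y + x) dx = -2π⁴‖y‖⁻⁶`, the dilation structure
`f_t(z) = t⁻⁶f₁(z/t)` and the gradient bounds are in the sequel `PricedLinkCensusLocalToGlobalThomsonKernelBounds`.)

References: D. Gilbarg, N. S. Trudinger, *Elliptic PDE of second order* (2001), (2.12)–(2.18);
E. H. Lieb, M. Loss, *Analysis* (2001), Thm 6.20 (`-Δ|x|^{2-n} = (n-2)|S^{n-1}| δ`), §9.7.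
-/

noncomputable section

open MeasureTheory Set Filter Metric Topology InnerProductSpace Function
open scoped RealInnerProductSpace Laplacian ContDiff
open Literature.Analysis.FluidPDE (cutoffProfile cutoffProfile_contDiff cutoffProfile_nonneg
  cutoffProfile_le_one cutoffProfile_eq_one cutoffProfile_eq_zero laplacian_comp_norm_sq
  hasFDerivAt_comp_norm_sq fderiv_comp_norm_sq_apply)

namespace Summit.AtomisticToContinuum.Crystallization.Theorems.PricedLinkCensusLocalToGlobal

variable {t : ℝ}

/-! ### The radial profile -/

/-- `σ ↦ σ⁻³` is smooth off `0`. [folklore] -/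
theorem contDiffAt_zpow_neg_three {σ : ℝ} (hσ : σ ≠ 0) {n : WithTop ℕ∞} :
    ContDiffAt ℝ n (fun τ : ℝ => τ ^ (-3 : ℤ)) σ := by
  have h : (fun τ : ℝ => τ ^ (-3 : ℤ)) = fun τ => (τ ^ 3)⁻¹ := by
    funext τ
    rw [zpow_neg, zpow_ofNat]
  rw [h]
  exact (contDiffAt_id.pow 3).inv (pow_ne_zero 3 hσ)

/-- **The profile is smooth on `ℝ`** (it vanishes near every `σ < t²/4`, and `σ⁻³` is smooth on `σ > 0`). [folklore] -/
theorem contDiff_farProfile8 (ht : 0 < t) {n : ℕ∞} : ContDiff ℝ n (farProfile8 t) := by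
  refine contDiff_iff_contDiffAt.2 fun σ => ?_
  by_cases hσ : σ < (t / 2) ^ 2
  · exact (contDiffAt_const (c := (0 : ℝ))).congr_of_eventuallyEq (farProfile8_eventuallyEq_zero ht hσ)
  · have hσ' : 0 < σ := (pow_pos (half_pos ht) 2).trans_le (not_lt.1 hσ)
    exact (contDiffAt_const.sub (cutoffProfile_contDiff (t / 2) t (n := n)).contDiffAt).mul
      (contDiffAt_zpow_neg_three hσ'.ne')

/-- `g_t` has derivative `g_t′` everywhere. [folklore] -/
theorem hasDerivAt_farProfile8 (ht : 0 < t) (σ : ℝ) :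
    HasDerivAt (farProfile8 t) (farProfile8₁ t σ) σ :=
  ((contDiff_farProfile8 ht (n := 1)).differentiable one_ne_zero σ).hasDerivAt

/-- `g_t′` is smooth. [folklore] -/
theorem contDiff_farProfile8₁ (ht : 0 < t) {n : ℕ∞} : ContDiff ℝ n (farProfile8₁ t) := by
  have h : ContDiff ℝ ((n : WithTop ℕ∞) + 1) (farProfile8 t) := by
    exact_mod_cast contDiff_farProfile8 ht (n := n + 1)
  rw [contDiff_succ_iff_deriv] at h
  exact h.2.2

/-- `g_t′` has derivative `g_t″` everywhere. [folklore] -/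
theorem hasDerivAt_farProfile8₁ (ht : 0 < t) (σ : ℝ) :
    HasDerivAt (farProfile8₁ t) (farProfile8₂ t σ) σ :=
  ((contDiff_farProfile8₁ ht (n := 1)).differentiable one_ne_zero σ).hasDerivAt

/-- `g_t′` is continuous. [folklore] -/
theorem continuous_farProfile8₁ (ht : 0 < t) : Continuous (farProfile8₁ t) :=
  (contDiff_farProfile8₁ ht (n := 0)).continuous

/-- `g_t″` is continuous. [folklore] -/
theorem continuous_farProfile8₂ (ht : 0 < t) : Continuous (farProfile8₂ t) := by
  have h := contDiff_farProfile8₁ ht (n := 1)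
  rw [show ((1 : ℕ∞) : WithTop ℕ∞) = (0 : WithTop ℕ∞) + 1 by rfl, contDiff_succ_iff_deriv] at h
  exact h.2.2.continuous

/-- `g_t′(σ) = 0` for `σ < t²/4`. [folklore] -/
theorem farProfile8₁_eq_zero (ht : 0 < t) {σ : ℝ} (hσ : σ < (t / 2) ^ 2) : farProfile8₁ t σ = 0 := by
  rw [farProfile8₁, (farProfile8_eventuallyEq_zero ht hσ).deriv_eq, deriv_const]

/-- `g_t′(σ) = -3 σ⁻⁴` for `σ > t²`. [folklore] -/
theorem farProfile8₁_eq (ht : 0 < t) {σ : ℝ} (hσ : t ^ 2 < σ) :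
    farProfile8₁ t σ = -3 * σ ^ (-4 : ℤ) := by
  have hσ' : 0 < σ := lt_trans (pow_pos ht 2) hσ
  rw [farProfile8₁, (farProfile8_eventuallyEq_zpow ht hσ).deriv_eq,
    (hasDerivAt_zpow (-3) σ (Or.inl hσ'.ne')).deriv]
  norm_num

/-! ### The regularised kernel `f_t` on `ℝ⁸` -/

/-- **`f_t` is smooth.** [folklore] -/
theorem contDiff_newtonFar8 (ht : 0 < t) {n : ℕ∞} : ContDiff ℝ n (newtonFar8 t) :=
  (contDiff_farProfile8 ht).comp (contDiff_norm_sq ℝ)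

/-- **The Laplacian of `f_t`** (everywhere, including the origin): `Δf_t(z) = 4 g″(‖z‖²)‖z‖² + 16 g′(‖z‖²)`
(`2 · dim ℝ⁸ = 16`). [folklore] -/
theorem laplacian_newtonFar8_eq (ht : 0 < t) (z : E8) :
    (Δ (newtonFar8 t)) z = 4 * farProfile8₂ t (‖z‖ ^ 2) * ‖z‖ ^ 2 + 16 * farProfile8₁ t (‖z‖ ^ 2) := by
  rw [newtonFar8_eq_profile, laplacian_comp_norm_sq (E := E8) isOpen_univ
    (fun σ _ => hasDerivAt_farProfile8 ht σ) (mem_univ _) (hasDerivAt_farProfile8₁ ht _),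
    finrank_euclideanSpace_fin]
  push_cast
  ring

/-- `Δ f_t (z) = Λ_t(‖z‖)`. [folklore] -/
theorem laplacian_newtonFar8_eq_profile (ht : 0 < t) (z : E8) : (Δ (newtonFar8 t)) z = lapProfile8 t ‖z‖ :=
  laplacian_newtonFar8_eq ht z

/-- `Λ_t` is continuous. [folklore] -/
theorem continuous_lapProfile8 (ht : 0 < t) : Continuous (lapProfile8 t) := by
  unfold lapProfile8
  exact ((continuous_const.mul ((continuous_farProfile8₂ ht).comp (continuous_pow 2))).mul
    (continuous_pow 2)).add (continuous_const.mul ((continuous_farProfile8₁ ht).comp (continuous_pow 2)))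

/-- `Δ f_t` is continuous. [folklore] -/
theorem continuous_laplacian_newtonFar8 (ht : 0 < t) : Continuous (Δ (newtonFar8 t)) := by
  rw [show Δ (newtonFar8 t) = fun z => lapProfile8 t ‖z‖ from funext (laplacian_newtonFar8_eq_profile ht)]
  exact (continuous_lapProfile8 ht).comp continuous_norm

/-- `Δ f_t` is a radial function. [folklore] -/
theorem laplacian_newtonFar8_radial (ht : 0 < t) {x y : E8} (h : ‖x‖ = ‖y‖) :
    (Δ (newtonFar8 t)) x = (Δ (newtonFar8 t)) y := by
  rw [laplacian_newtonFar8_eq_profile ht, laplacian_newtonFar8_eq_profile ht, h]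

/-- `Δ f_t (z) = 0` for `‖z‖ < t/2` (`f_t` vanishes near `z`). [folklore] -/
theorem laplacian_newtonFar8_eq_zero_of_lt (ht : 0 < t) {z : E8} (hz : ‖z‖ < t / 2) :
    (Δ (newtonFar8 t)) z = 0 := by
  have hev : newtonFar8 t =ᶠ[𝓝 z] fun _ => (0 : ℝ) := by
    filter_upwards [(isOpen_lt continuous_norm continuous_const).mem_nhds hz] with w hw
    exact newtonFar8_eq_zero ht hw.le
  rw [(laplacian_congr_nhds hev).eq_of_nhds]
  simp [InnerProductSpace.laplacian_eq_iteratedFDeriv_stdOrthonormalBasis]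

/-- `Δ f_t (z) = 0` for `‖z‖ > t` (there `f_t = ‖·‖⁻⁶` near `z`, harmonic). [folklore] -/
theorem laplacian_newtonFar8_eq_zero_of_gt (ht : 0 < t) {z : E8} (hz : t < ‖z‖) :
    (Δ (newtonFar8 t)) z = 0 := by
  have hev : newtonFar8 t =ᶠ[𝓝 z] fun w : E8 => (‖w‖ ^ 2) ^ (-3 : ℤ) := by
    filter_upwards [(isOpen_lt continuous_const continuous_norm).mem_nhds hz] with w hw
    rw [newtonFar8, farProfile8_eq_zpow ht (pow_le_pow_left₀ ht.le hw.le 2)]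
  rw [(laplacian_congr_nhds hev).eq_of_nhds]
  -- `Δ (‖·‖²)⁻³ = 0` off the origin of `ℝ⁸`: `4·12·σ⁻⁵·σ - 16·3·σ⁻⁴ = 0`
  have hz0 : z ≠ 0 := norm_pos_iff.1 (ht.trans hz)
  have hg : ∀ σ ∈ Ioi (0 : ℝ), HasDerivAt (fun σ : ℝ => σ ^ (-3 : ℤ)) (((-3 : ℤ) : ℝ) * σ ^ ((-3 : ℤ) - 1)) σ :=
    fun σ hσ => hasDerivAt_zpow (-3) σ (Or.inl (ne_of_gt hσ))
  have hz2 : ‖z‖ ^ 2 ∈ Ioi (0 : ℝ) := pow_pos (norm_pos_iff.2 hz0) 2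
  have hg₁ : HasDerivAt (fun σ : ℝ => ((-3 : ℤ) : ℝ) * σ ^ ((-3 : ℤ) - 1))
      (((-3 : ℤ) : ℝ) * ((((-3 : ℤ) - 1 : ℤ) : ℝ) * (‖z‖ ^ 2) ^ ((-3 : ℤ) - 1 - 1))) (‖z‖ ^ 2) :=
    (hasDerivAt_zpow ((-3) - 1) _ (Or.inl (ne_of_gt hz2))).const_mul _
  rw [laplacian_comp_norm_sq isOpen_Ioi hg hz2 hg₁, finrank_euclideanSpace_fin]
  have hs : (‖z‖ ^ 2 : ℝ) ≠ 0 := ne_of_gt hz2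
  rw [zpow_sub_one₀ hs ((-3 : ℤ) - 1)]
  push_cast
  field_simp
  ring

/-- `Λ_t(r) = 0` for `r > t`. [folklore] -/
theorem lapProfile8_eq_zero_of_gt (ht : 0 < t) {r : ℝ} (hr : t < r) : lapProfile8 t r = 0 := by
  obtain ⟨e, he⟩ := exists_norm_eq E8 zero_le_one
  have hr0 : 0 < r := ht.trans hr
  have hn : ‖r • e‖ = r := by rw [norm_smul, he, mul_one, Real.norm_eq_abs, abs_of_pos hr0]
  rw [← hn, ← laplacian_newtonFar8_eq_profile ht, laplacian_newtonFar8_eq_zero_of_gt ht (by rwa [hn])]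

/-- `Δ f_t (z) = 0` for `‖z‖ ≥ 2t` (a convenient closed form of the previous lemma). [folklore] -/
theorem laplacian_newtonFar8_eq_zero_of_le (ht : 0 < t) {z : E8} (hz : 2 * t ≤ ‖z‖) :
    (Δ (newtonFar8 t)) z = 0 :=
  laplacian_newtonFar8_eq_zero_of_gt ht (by linarith)

/-- `Δ f_t` has compact support (it vanishes off the closed ball of radius `2t`). [folklore] -/
theorem hasCompactSupport_laplacian_newtonFar8 (ht : 0 < t) : HasCompactSupport (Δ (newtonFar8 t)) := by
  refine HasCompactSupport.intro (isCompact_closedBall (0 : E8) (2 * t)) fun z hz => ?_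
  rw [mem_closedBall_zero_iff, not_le] at hz
  exact laplacian_newtonFar8_eq_zero_of_le ht hz.le

/-- `Δ f_t ∈ L¹`. [folklore] -/
theorem integrable_laplacian_newtonFar8 (ht : 0 < t) : Integrable (Δ (newtonFar8 t)) :=
  (continuous_laplacian_newtonFar8 ht).integrable_of_hasCompactSupport
    (hasCompactSupport_laplacian_newtonFar8 ht)

/-! ### The flux `∫ Δ f_t = -2π⁴` -/

/-- `vol(B₁(ℝ⁸)) = π⁴/24` (Mathlib `EuclideanSpace.volume_ball`, `Γ(5) = 24`). [folklore] -/
theorem volume_real_ball_E8 : (volume : Measure E8).real (ball 0 1) = Real.pi ^ 4 / 24 := by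
  rw [measureReal_def, EuclideanSpace.volume_ball (Fin 8) (0 : E8) 1]
  simp only [Fintype.card_fin, ENNReal.ofReal_one, one_pow, one_mul]
  rw [ENNReal.toReal_ofReal (by positivity)]
  have h1 : Real.sqrt Real.pi ^ 8 = Real.pi ^ 4 := by
    rw [show (8 : ℕ) = 2 * 4 by norm_num, pow_mul, Real.sq_sqrt Real.pi_pos.le]
  have h2 : Real.Gamma ((8 : ℕ) / 2 + 1 : ℝ) = 24 := by
    rw [show ((8 : ℕ) / 2 + 1 : ℝ) = (4 : ℕ) + 1 by norm_num, Real.Gamma_nat_eq_factorial]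
    norm_num [Nat.factorial]
  rw [h1, h2]

/-- The radial primitive: `r ↦ 2 r⁸ g′(r²)` has derivative `r⁷ Λ_t(r)`. [folklore] -/
theorem hasDerivAt_radialFlux8 (ht : 0 < t) (r : ℝ) :
    HasDerivAt (fun r => 2 * r ^ 8 * farProfile8₁ t (r ^ 2)) (r ^ 7 * lapProfile8 t r) r := by
  have h1 : HasDerivAt (fun r : ℝ => r ^ 2) (2 * r) r := by simpa using hasDerivAt_pow 2 r
  have h2 : HasDerivAt (fun r : ℝ => farProfile8₁ t (r ^ 2)) (farProfile8₂ t (r ^ 2) * (2 * r)) r :=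
    (hasDerivAt_farProfile8₁ ht (r ^ 2)).comp r h1
  have h3 : HasDerivAt (fun r : ℝ => 2 * r ^ 8) (2 * (8 * r ^ 7)) r := by
    simpa using (hasDerivAt_pow 8 r).const_mul 2
  refine (h3.mul h2).congr_deriv ?_
  rw [lapProfile8]
  ring

/-- The flux constant: `2 r⁸ g′(r²) = -6` beyond the cut-off (`g′ = -3σ⁻⁴` there). [folklore] -/
theorem radialFlux8_eq_of_gt (ht : 0 < t) {r : ℝ} (hr : t < r) : 2 * r ^ 8 * farProfile8₁ t (r ^ 2) = -6 := by
  have hr0 : 0 < r := ht.trans hr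
  have hσ : t ^ 2 < r ^ 2 := by gcongr
  have h8 : ((r ^ 2) ^ (-4 : ℤ) : ℝ) = (r ^ 8)⁻¹ := by
    rw [zpow_neg, zpow_ofNat, ← pow_mul]
  rw [farProfile8₁_eq ht hσ, h8]
  field_simp [pow_ne_zero 8 hr0.ne']
  ring

/-- **The flux of the regularised kernel**: `∫_{ℝ⁸} Δ f_t = -2π⁴` — the total flux of `∇‖·‖⁻⁶` through
a large sphere is `-6|S⁷| = -2π⁴` (Lieb–Loss Thm 6.20: `-Δ|x|^{2-n} = (n-2)|S^{n-1}|δ₀`), computed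
boundary-free in polar coordinates from `r⁷Λ_t(r) = (2r⁸g′(r²))′`. [cite: LiebLoss2001, Thm 6.20] -/
theorem integral_laplacian_newtonFar8 (ht : 0 < t) : ∫ z, (Δ (newtonFar8 t)) z = -(2 * Real.pi ^ 4) := by
  set Λ := lapProfile8 t with hΛ
  have hΛc : Continuous Λ := continuous_lapProfile8 ht
  have h1 : ∫ z, (Δ (newtonFar8 t)) z = ∫ z : E8, Λ ‖z‖ :=
    integral_congr_ae (Eventually.of_forall fun z => laplacian_newtonFar8_eq_profile ht z)
  rw [h1, integral_fun_norm_addHaar volume Λ, finrank_euclideanSpace_fin, volume_real_ball_E8]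
  -- the one-dimensional integral `∫₀^∞ r⁷ Λ(r) dr = -6`
  set R := t + 1 with hR
  set Fl : ℝ → ℝ := fun r => 2 * r ^ 8 * farProfile8₁ t (r ^ 2) with hFl
  have hzero : ∀ r, t < r → r ^ 7 * Λ r = 0 := fun r hr => by
    rw [hΛ, lapProfile8_eq_zero_of_gt ht hr, mul_zero]
  have hIoc : IntegrableOn (fun r => r ^ 7 * Λ r) (Ioc 0 R) :=
    ((continuous_pow 7).mul hΛc).integrableOn_Icc.mono_set Ioc_subset_Icc_self
  have hIoi : IntegrableOn (fun r => r ^ 7 * Λ r) (Ioi R) := by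
    refine integrableOn_zero.congr_fun (fun r hr => ?_) measurableSet_Ioi
    exact (hzero r (by rw [mem_Ioi] at hr; linarith)).symm
  have h3 : ∫ r in Ioi (0 : ℝ), r ^ 7 * Λ r = ∫ r in Ioc (0 : ℝ) R, r ^ 7 * Λ r := by
    rw [← Ioc_union_Ioi_eq_Ioi (by linarith : (0 : ℝ) ≤ R),
      setIntegral_union (Set.Ioc_disjoint_Ioi le_rfl) measurableSet_Ioi hIoc hIoi]
    have : ∫ r in Ioi R, r ^ 7 * Λ r = 0 := by
      refine (setIntegral_congr_fun measurableSet_Ioi fun r hr => hzero r ?_).trans (integral_zero _ _)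
      rw [mem_Ioi] at hr; linarith
    rw [this, add_zero]
  have h4 : ∫ r in Ioc (0 : ℝ) R, r ^ 7 * Λ r = Fl R - Fl 0 := by
    rw [← intervalIntegral.integral_of_le (by linarith : (0 : ℝ) ≤ R)]
    exact intervalIntegral.integral_eq_sub_of_hasDerivAt (fun r _ => hasDerivAt_radialFlux8 ht r)
      (((continuous_pow 7).mul hΛc).intervalIntegrable _ _)
  have h5 : Fl R = -6 := radialFlux8_eq_of_gt ht (by linarith)
  have h6 : Fl 0 = 0 := by simp only [hFl]; ring
  have h8 : ∫ y in Ioi (0 : ℝ), y ^ (8 - 1) • Λ y = -6 := by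
    simp_rw [smul_eq_mul]
    show ∫ y in Ioi (0 : ℝ), y ^ 7 * Λ y = -6
    rw [h3, h4, h5, h6, sub_zero]
  rw [h8]
  simp only [nsmul_eq_mul, smul_eq_mul]
  push_cast
  ring

/-- **Registered sub-goal `newtonFar8_flux`** (line `flux-cell-joint-census`, support of `stub_confinedThomson`):
the flux identity `∫ Δ f_t = -2π⁴` for every `t > 0`, binder-free form of `integral_laplacian_newtonFar8`.
[cite: LiebLoss2001, Thm 6.20] -/
theorem newtonFar8_flux : ∀ t : ℝ, 0 < t → ∫ z, (Δ (newtonFar8 t)) z = -(2 * Real.pi ^ 4) :=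
  fun _ ht => integral_laplacian_newtonFar8 ht

end Summit.AtomisticToContinuum.Crystallization.Theorems.PricedLinkCensusLocalToGlobal

end
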